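import Mathlib
import Literature.Probability.Percolation.DiagonalStripTransferInsertionUpdate
import Literature.Probability.Percolation.DiagonalStripTransferFusion
import Literature.Probability.Percolation.DiagonalStripTransferInterlacingTwoRow
import HarnessLib

/-!
# IP12 Lemma 3.3: the transfer-matrix recursion `t_L(z_{i+1} = q z_i) ∘ φ_i = φ_i ∘ t_{L-2}(ẑ)`

Topic `Literature/Probability/Percolation`. Ikhlef–Ponsaing (J. Stat. Phys. 149 (2012),
arXiv:1202.5476) Lemma 3.3, proved in the cluster language for the lumped two-row kernel
`ipTransferMatrixW` of `DiagonalStripTransferInhomogeneous.lean` (IP12's `t(w; z_1, …, z_L)`,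
`L = 2n+1`), over any field with `q² + q + 1 = 0` and arbitrary inhomogeneities away from the poles
of the weights:

* **`ipTransferMatrixW_cpInsIso`** (even insertion point `i = 2b`, `φ_i = cpInsIso b`) and
  **`ipTransferMatrixW_cpInsDup`** (odd `i = 2j+1`, `φ_i = cpInsDup j`): at `z_{i+1} = q z_i`,
  `t_{L+2}(w; z)(φ_i Q, Q'') = Σ_{Q' : φ_i Q' = Q''} t_L(w; ẑ)(Q, Q')` with `ẑ = zHat z i` (the
  rapidities at levels `i, i+1` removed); corollaries `…_cpInsIso_cpInsIso`, `…_cpInsDup_cpInsDup`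
  (the recursion on inserted states) and `…_eq_zero` (`t` does not lead out of the inserted states).

The proof follows IP12's picture proof: in each of the two rows the inserted site carries two tiles
whose distinguished edge pattern (both open through a singleton source = duplication of the target;
both closed into a new target from a duplicated source = singleton insertion) has weight exactly `1`
by the fusion identities `A(q y) B(y) = 1`, `(1 - A(y))(1 - B(q y)) = 1`
(`DiagonalStripTransferFusion.lean`), while the other three patterns act identically
(`DiagonalStripTransferInsertionUpdate.lean`) and so carry total weight `0`; the shifted old edges
carry the `ẑ`-weights (`ipRowWeight_layerEmb_insSrcIdx/insTgtIdx`), and the row-`0` output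
insertion is the row-`1` input insertion, which commutes with lumping.

* `sum_powerset_insert_bernoulli`, `sum_powerset_insert_insert_bernoulli`,
  `sum_powerset_image_bernoulli` — conditioning a Bernoulli edge sum on one or two edges, pushing
  it along an injection;
* `ipTransferWIdx_cpInsIso`, `ipTransferWIdx_cpInsDup` — one layer with abstract weights;
  `ipTransferW_cpInsIso`, `ipTransferW_cpInsDup` — one row with IP12's weights;
* `ipTwoLayerW_push` — the two-row push-forward principle; `lump_cpInsIso`, `lump_cpInsDup`.

## References

* Y. Ikhlef, A. K. Ponsaing, *Finite-size left-passage probability in percolation*, J. Stat. Phys.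
  149 (2012) 10–36, arXiv:1202.5476, Lemma 3.3 and its proof (pictures p. 6–7). [IkhlefPonsaing2012]
-/

namespace Literature.Probability.Percolation

open Finset Literature.Probability.LatticeModels Literature.Probability.LatticeModels.TemperleyLieb

/-! ### Conditioning a Bernoulli edge sum on one or two edges -/

section Conditioning

variable {α β K : Type*} [CommRing K] [DecidableEq α] [DecidableEq β]

/-- **Conditioning on one edge**: splitting the Bernoulli sum over subsets of `insert e A` according
to whether `e` is open. [folklore] -/
theorem sum_powerset_insert_bernoulli {e : α} {A : Finset α} (he : e ∉ A) (ω : α → K) (F : Finset α → K) :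
    ∑ J ∈ (insert e A).powerset, ((∏ p ∈ J, ω p) * ∏ p ∈ insert e A \ J, (1 - ω p)) * F J =
      ω e * ∑ I ∈ A.powerset, ((∏ p ∈ I, ω p) * ∏ p ∈ A \ I, (1 - ω p)) * F (insert e I) +
        (1 - ω e) * ∑ I ∈ A.powerset, ((∏ p ∈ I, ω p) * ∏ p ∈ A \ I, (1 - ω p)) * F I := by
  rw [Finset.sum_powerset_insert he, add_comm, Finset.mul_sum, Finset.mul_sum]
  congr 1
  · refine Finset.sum_congr rfl fun I hI => ?_
    have hI' : I ⊆ A := Finset.mem_powerset.1 hI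
    have heI : e ∉ I := fun h => he (hI' h)
    rw [Finset.prod_insert heI, Finset.insert_sdiff_insert, Finset.sdiff_insert_of_notMem he]
    ring
  · refine Finset.sum_congr rfl fun I hI => ?_
    have hI' : I ⊆ A := Finset.mem_powerset.1 hI
    have heI : e ∉ I := fun h => he (hI' h)
    rw [Finset.insert_sdiff_of_notMem A heI,
      Finset.prod_insert (fun h => he (Finset.mem_sdiff.1 h).1)]
    ring

/-- **Conditioning on two edges.** [folklore] -/
theorem sum_powerset_insert_insert_bernoulli {e₁ e₂ : α} {A : Finset α} (h₁₂ : e₁ ≠ e₂) (he₁ : e₁ ∉ A)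
    (he₂ : e₂ ∉ A) (ω : α → K) (F : Finset α → K) :
    ∑ J ∈ (insert e₁ (insert e₂ A)).powerset,
        ((∏ p ∈ J, ω p) * ∏ p ∈ insert e₁ (insert e₂ A) \ J, (1 - ω p)) * F J =
      ∑ I ∈ A.powerset, ((∏ p ∈ I, ω p) * ∏ p ∈ A \ I, (1 - ω p)) *
        (ω e₁ * ω e₂ * F (insert e₁ (insert e₂ I)) + ω e₁ * (1 - ω e₂) * F (insert e₁ I) +
          (1 - ω e₁) * ω e₂ * F (insert e₂ I) + (1 - ω e₁) * (1 - ω e₂) * F I) := by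
  have he₁' : e₁ ∉ insert e₂ A := by simp [h₁₂, he₁]
  rw [sum_powerset_insert_bernoulli he₁', sum_powerset_insert_bernoulli he₂ ω F,
    sum_powerset_insert_bernoulli he₂ ω (fun I => F (insert e₁ I))]
  simp only [Finset.mul_sum, ← Finset.sum_add_distrib]
  refine Finset.sum_congr rfl fun I _ => ?_
  ring

/-- **Pushing a Bernoulli sum forward along an injection** with matching weights. [folklore] -/
theorem sum_powerset_image_bernoulli (L : Finset α) {ι : α → β} (hι : Function.Injective ι) (ω' : β → K)
    (ω : α → K) (hω : ∀ p ∈ L, ω' (ι p) = ω p) (G : Finset β → K) :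
    ∑ J ∈ (L.image ι).powerset, ((∏ p ∈ J, ω' p) * ∏ p ∈ L.image ι \ J, (1 - ω' p)) * G J =
      ∑ I ∈ L.powerset, ((∏ p ∈ I, ω p) * ∏ p ∈ L \ I, (1 - ω p)) * G (I.image ι) := by
  rw [Finset.powerset_image, Finset.sum_image fun I _ J _ h => Finset.image_injective hι h]
  refine Finset.sum_congr rfl fun I hI => ?_
  have hIL : I ⊆ L := Finset.mem_powerset.1 hI
  rw [Finset.prod_image fun a _ b _ h => hι h, ← Finset.image_sdiff _ _ hι,
    Finset.prod_image fun a _ b _ h => hι h,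
    Finset.prod_congr rfl fun p hp => hω p (hIL hp),
    Finset.prod_congr rfl fun p hp => show 1 - ω' (ι p) = 1 - ω p by rw [hω p (Finset.mem_sdiff.1 hp).1]]

/-- An indicator-weighted term as a product. [folklore] -/
theorem ite_eq_mul_indicator (P : Prop) [Decidable P] (x : K) :
    (if P then x else 0) = x * (if P then 1 else 0) := by
  split_ifs <;> simp

end Conditioning

/-! ### The one-layer kernel after an insertion -/

section LayerInsertion

variable {K : Type*} [Field K] {n : ℕ}

/-- `{x, y} ∪`-form of the big layer as a double insertion. [folklore] -/
theorem union_pair_eq_insert_insert {α : Type*} [DecidableEq α] (A : Finset α) (x y : α) :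
    A ∪ {x, y} = insert x (insert y A) := by
  ext p; simp only [Finset.mem_union, Finset.mem_insert, Finset.mem_singleton]; tauto

/-- The fibre sum of an indicator. [folklore] -/
theorem sum_filter_ite_eq {γ δ : Type*} [Fintype γ] [DecidableEq γ] [DecidableEq δ] (ψ : γ → δ) (y : δ)
    (x : γ) (w : K) :
    ∑ P' ∈ Finset.univ.filter (fun P' => ψ P' = y), (if x = P' then w else 0) = if ψ x = y then w else 0 := by
  rw [Finset.sum_ite_eq]
  simp

/-- **One layer after inserting a singleton source with both new edges of total weight `u v = 1`:**
the big kernel from `cpInsIso a Q` is the push-forward along `cpInsDup j₀` of the small kernel.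
[cite: IkhlefPonsaing2012, Lemma 3.3] -/
theorem ipTransferWIdx_cpInsIso (c : ℤ) (a : Fin (n + 2)) (j₀ : Fin (n + 1))
    (haj : (c % 2 = 0 ∧ (a : ℕ) = j₀ + 1) ∨ (c % 2 = 1 ∧ (a : ℕ) = j₀))
    (ω' : Fin (n + 2) × Fin (n + 2) → K) (ω : Fin (n + 1) × Fin (n + 1) → K)
    (hω : ∀ p ∈ latticeIdx n c, ω' (insSrcIdx a p) = ω p)
    (hnew : ω' (a, j₀.castSucc) * ω' (a, j₀.succ) = 1) (Q : ColPattern n) (P'' : ColPattern (n + 1)) :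
    ipTransferWIdx (n + 1) c ω' (cpInsIso a Q) P'' =
      ∑ P' ∈ Finset.univ.filter (fun P' => cpInsDup j₀ P' = P''), ipTransferWIdx n c ω Q P' := by
  classical
  have h₁₂ : ((a, j₀.castSucc) : Fin (n + 2) × Fin (n + 2)) ≠ (a, j₀.succ) := by
    simp [Prod.ext_iff, Fin.ext_iff]
  have he₁ : ((a, j₀.castSucc) : Fin (n + 2) × Fin (n + 2)) ∉ (latticeIdx n c).image (insSrcIdx a) := by
    simp only [Finset.mem_image, not_exists, not_and]
    exact fun p _ h => insSrcIdx_ne_new a p _ h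
  have he₂ : ((a, j₀.succ) : Fin (n + 2) × Fin (n + 2)) ∉ (latticeIdx n c).image (insSrcIdx a) := by
    simp only [Finset.mem_image, not_exists, not_and]
    exact fun p _ h => insSrcIdx_ne_new a p _ h
  unfold ipTransferWIdx
  rw [latticeIdx_succ_eq_insSrc c a j₀ haj, union_pair_eq_insert_insert]
  rw [Finset.sum_congr rfl fun J _ => ite_eq_mul_indicator _ _]
  rw [sum_powerset_insert_insert_bernoulli h₁₂ he₁ he₂,
    sum_powerset_image_bernoulli (latticeIdx n c) (insSrcIdx_injective a) ω' ω hω]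
  -- identify the four outputs
  rw [Finset.sum_comm]
  refine Finset.sum_congr rfl fun I hI => ?_
  have hIL : I ⊆ latticeIdx n c := Finset.mem_powerset.1 hI
  have hleaf : ∀ t, colUpdate (n + 1) c (cpInsIso a Q) (idxEdgeFn (insert (a, t) (I.image (insSrcIdx a)))) =
      colUpdate (n + 1) c (cpInsIso a Q) (idxEdgeFn (I.image (insSrcIdx a))) := fun t =>
    colUpdate_cpInsIso_leaf c a t Q _ (by
      simp only [Finset.mem_image, forall_exists_index, and_imp]
      rintro _ p _ rfl; exact insSrcIdx_fst_ne a p)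
  rw [colUpdate_cpInsIso_open c a j₀ haj Q hIL, hleaf, hleaf, sum_filter_ite_eq]
  by_cases hA : cpInsDup j₀ (colUpdate n c Q (idxEdgeFn I)) = P''
  · by_cases hB : colUpdate (n + 1) c (cpInsIso a Q) (idxEdgeFn (I.image (insSrcIdx a))) = P''
    · simp only [if_pos hA, if_pos hB]; ring
    · simp only [if_pos hA, if_neg hB]
      linear_combination ((∏ p ∈ I, ω p) * ∏ p ∈ latticeIdx n c \ I, (1 - ω p)) * hnew
  · by_cases hB : colUpdate (n + 1) c (cpInsIso a Q) (idxEdgeFn (I.image (insSrcIdx a))) = P''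
    · simp only [if_neg hA, if_pos hB]
      linear_combination -((∏ p ∈ I, ω p) * ∏ p ∈ latticeIdx n c \ I, (1 - ω p)) * hnew
    · simp only [if_neg hA, if_neg hB]; ring

/-- **One layer after duplicating a source with both new edges of total closed-weight
`(1-u)(1-v) = 1`:** the big kernel from `cpInsDup j₀ Q` is the push-forward along `cpInsIso a` of the
small kernel. [cite: IkhlefPonsaing2012, Lemma 3.3] -/
theorem ipTransferWIdx_cpInsDup (c : ℤ) (a : Fin (n + 2)) (j₀ : Fin (n + 1))
    (haj : (c % 2 = 0 ∧ (a : ℕ) = j₀) ∨ (c % 2 = 1 ∧ (a : ℕ) = j₀ + 1))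
    (ω' : Fin (n + 2) × Fin (n + 2) → K) (ω : Fin (n + 1) × Fin (n + 1) → K)
    (hω : ∀ p ∈ latticeIdx n c, ω' (insTgtIdx a p) = ω p)
    (hnew : (1 - ω' (j₀.castSucc, a)) * (1 - ω' (j₀.succ, a)) = 1) {Q : ColPattern n}
    (hQ : Q.1 j₀ j₀ = true) (P'' : ColPattern (n + 1)) :
    ipTransferWIdx (n + 1) c ω' (cpInsDup j₀ Q) P'' =
      ∑ P' ∈ Finset.univ.filter (fun P' => cpInsIso a P' = P''), ipTransferWIdx n c ω Q P' := by
  classical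
  have h₁₂ : ((j₀.castSucc, a) : Fin (n + 2) × Fin (n + 2)) ≠ (j₀.succ, a) := by
    simp [Prod.ext_iff, Fin.ext_iff]
  have he₁ : ((j₀.castSucc, a) : Fin (n + 2) × Fin (n + 2)) ∉ (latticeIdx n c).image (insTgtIdx a) := by
    simp only [Finset.mem_image, not_exists, not_and]
    exact fun p _ h => insTgtIdx_snd_ne a p (congrArg Prod.snd h)
  have he₂ : ((j₀.succ, a) : Fin (n + 2) × Fin (n + 2)) ∉ (latticeIdx n c).image (insTgtIdx a) := by
    simp only [Finset.mem_image, not_exists, not_and]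
    exact fun p _ h => insTgtIdx_snd_ne a p (congrArg Prod.snd h)
  unfold ipTransferWIdx
  rw [latticeIdx_succ_eq_insTgt c a j₀ haj, union_pair_eq_insert_insert]
  rw [Finset.sum_congr rfl fun J _ => ite_eq_mul_indicator _ _]
  rw [sum_powerset_insert_insert_bernoulli h₁₂ he₁ he₂,
    sum_powerset_image_bernoulli (latticeIdx n c) (insTgtIdx_injective a) ω' ω hω]
  rw [Finset.sum_comm]
  refine Finset.sum_congr rfl fun I hI => ?_
  have hIL : I ⊆ latticeIdx n c := Finset.mem_powerset.1 hI
  obtain ⟨hA, hB⟩ := colUpdate_cpInsDup_open_eq c a j₀ hQ (I.image (insTgtIdx a))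
  rw [colUpdate_cpInsDup_closed c a j₀ haj hQ hIL, hA, hB, sum_filter_ite_eq]
  by_cases hA' : cpInsIso a (colUpdate n c Q (idxEdgeFn I)) = P''
  · by_cases hB' : colUpdate (n + 1) c (cpInsDup j₀ Q)
        (idxEdgeFn (insert (j₀.castSucc, a) (I.image (insTgtIdx a)))) = P''
    · simp only [if_pos hA', if_pos hB']; ring
    · simp only [if_pos hA', if_neg hB']
      linear_combination ((∏ p ∈ I, ω p) * ∏ p ∈ latticeIdx n c \ I, (1 - ω p)) * hnew
  · by_cases hB' : colUpdate (n + 1) c (cpInsDup j₀ Q)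
        (idxEdgeFn (insert (j₀.castSucc, a) (I.image (insTgtIdx a)))) = P''
    · simp only [if_neg hA', if_pos hB']
      linear_combination -((∏ p ∈ I, ω p) * ∏ p ∈ latticeIdx n c \ I, (1 - ω p)) * hnew
    · simp only [if_neg hA', if_neg hB']; ring

end LayerInsertion

/-! ### IP12's row weights under the insertions -/

section ZHat

variable {L : Type*}

/-- **IP12's `ẑ`**: the rapidity sequence with the two entries at levels `i, i+1` removed (levels
`k < i` unchanged, levels `k ≥ i` read two steps higher). [cite: IkhlefPonsaing2012, Lemma 3.3] -/
def zHat (z : ℕ → L) (i : ℕ) : ℕ → L := fun k => if k < i then z k else z (k + 2)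

/-- Unfolding of `zHat`. [folklore] -/
theorem zHat_apply (z : ℕ → L) (i k : ℕ) : zHat z i k = if k < i then z k else z (k + 2) := rfl

end ZHat

section Weights

variable {K : Type*} [Field K] {m n : ℕ}

/-- **The top level of the lattice edge `(i, j)` of the layer `c ∈ {0, 1}` is `i + j + 1`.** [folklore] -/
theorem edgeTopLevel_layerEmb {c : ℤ} (hc : c = 0 ∨ c = 1) {p : Fin (m + 1) × Fin (m + 1)}
    (hp : p ∈ latticeIdx m c) : (edgeTopLevel (layerEmb m c p)).toNat = (p.1 : ℕ) + p.2 + 1 := by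
  rw [mem_latticeIdx_iff] at hp
  rw [layerEmb_apply, edgeTopLevel_mk_colSite]
  rcases hc with rfl | rfl <;> omega

/-- The row weight of a lattice edge of layer `c ∈ {0,1}` in terms of its index pair. [folklore] -/
theorem ipRowWeight_layerEmb {c : ℤ} (hc : c = 0 ∨ c = 1) (q w : K) (z : ℕ → K) (r : Fin 2)
    {p : Fin (m + 1) × Fin (m + 1)} (hp : p ∈ latticeIdx m c) :
    ipRowWeight q w z r (layerEmb m c p) =
      if ((p.1 : ℕ) + p.2 + 1) % 2 = 1 then ipWtA q (if r = 0 then z (p.1 + p.2 + 1) / w else (w * z (p.1 + p.2 + 1))⁻¹)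
      else ipWtB q (if r = 0 then z (p.1 + p.2 + 1) / w else (w * z (p.1 + p.2 + 1))⁻¹) :=
  ipRowWeight_eq_of_level q w z r (edgeTopLevel_layerEmb hc hp)

/-- **Weights of shifted old edges after a source insertion are the `ẑ`-weights of the old edges**
(`i = a + j₀ + 1` is the level of the lower new edge). [cite: IkhlefPonsaing2012, Lemma 3.3] -/
theorem ipRowWeight_layerEmb_insSrcIdx {c : ℤ} (a : Fin (n + 2)) (j₀ : Fin (n + 1))
    (haj : (c = 0 ∧ (a : ℕ) = j₀ + 1) ∨ (c = 1 ∧ (a : ℕ) = j₀)) (q w : K) (z : ℕ → K) (r : Fin 2)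
    {p : Fin (n + 1) × Fin (n + 1)} (hp : p ∈ latticeIdx n c) :
    ipRowWeight q w z r (layerEmb (n + 1) c (insSrcIdx a p)) =
      ipRowWeight q w (zHat z (a + j₀ + 1)) r (layerEmb n c p) := by
  have hc : c = 0 ∨ c = 1 := haj.elim (fun h => Or.inl h.1) fun h => Or.inr h.1
  have hk' : (edgeTopLevel (layerEmb (n + 1) c (insSrcIdx a p))).toNat =
      if (p.1 : ℕ) < a then (p.1 : ℕ) + p.2 + 1 else (p.1 : ℕ) + p.2 + 3 := by
    rw [layerEmb_apply, edgeTopLevel_mk_colSite, (val_insSrcIdx a p).1, (val_insSrcIdx a p).2]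
    rw [mem_latticeIdx_iff] at hp
    rcases hc with rfl | rfl <;> split_ifs <;> omega
  have hthr : (p.1 : ℕ) < a ↔ (p.1 : ℕ) + p.2 + 1 < a + j₀ + 1 := by
    rw [mem_latticeIdx_iff] at hp
    rcases haj with ⟨rfl, ha⟩ | ⟨rfl, ha⟩ <;> omega
  rw [ipRowWeight_eq_of_level q w z r hk', ipRowWeight_layerEmb hc q w _ r hp]
  by_cases h : (p.1 : ℕ) < a
  · have h' := hthr.1 h
    simp only [if_pos h, zHat_apply, if_pos h']
  · have h' : ¬ ((p.1 : ℕ) + p.2 + 1 < a + j₀ + 1) := fun h' => h (hthr.2 h')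
    have hpar : ((p.1 : ℕ) + p.2 + 3) % 2 = ((p.1 : ℕ) + p.2 + 1) % 2 := by omega
    simp only [if_neg h, zHat_apply, if_neg h', hpar]

/-- **Weights of shifted old edges after a target insertion are the `ẑ`-weights of the old edges.**
[cite: IkhlefPonsaing2012, Lemma 3.3] -/
theorem ipRowWeight_layerEmb_insTgtIdx {c : ℤ} (a : Fin (n + 2)) (j₀ : Fin (n + 1))
    (haj : (c = 0 ∧ (a : ℕ) = j₀) ∨ (c = 1 ∧ (a : ℕ) = j₀ + 1)) (q w : K) (z : ℕ → K) (r : Fin 2)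
    {p : Fin (n + 1) × Fin (n + 1)} (hp : p ∈ latticeIdx n c) :
    ipRowWeight q w z r (layerEmb (n + 1) c (insTgtIdx a p)) =
      ipRowWeight q w (zHat z (a + j₀ + 1)) r (layerEmb n c p) := by
  have hc : c = 0 ∨ c = 1 := haj.elim (fun h => Or.inl h.1) fun h => Or.inr h.1
  have hk' : (edgeTopLevel (layerEmb (n + 1) c (insTgtIdx a p))).toNat =
      if (p.2 : ℕ) < a then (p.1 : ℕ) + p.2 + 1 else (p.1 : ℕ) + p.2 + 3 := by
    rw [layerEmb_apply, edgeTopLevel_mk_colSite, (val_insTgtIdx a p).1, (val_insTgtIdx a p).2]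
    rw [mem_latticeIdx_iff] at hp
    rcases hc with rfl | rfl <;> split_ifs <;> omega
  have hthr : (p.2 : ℕ) < a ↔ (p.1 : ℕ) + p.2 + 1 < a + j₀ + 1 := by
    rw [mem_latticeIdx_iff] at hp
    rcases haj with ⟨rfl, ha⟩ | ⟨rfl, ha⟩ <;> omega
  rw [ipRowWeight_eq_of_level q w z r hk', ipRowWeight_layerEmb hc q w _ r hp]
  by_cases h : (p.2 : ℕ) < a
  · have h' := hthr.1 h
    simp only [if_pos h, zHat_apply, if_pos h']
  · have h' : ¬ ((p.1 : ℕ) + p.2 + 1 < a + j₀ + 1) := fun h' => h (hthr.2 h')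
    have hpar : ((p.1 : ℕ) + p.2 + 3) % 2 = ((p.1 : ℕ) + p.2 + 1) % 2 := by omega
    simp only [if_neg h, zHat_apply, if_neg h', hpar]

/-- The levels of the two new edges of a source insertion. [folklore] -/
theorem edgeTopLevel_new_src {c : ℤ} (a : Fin (n + 2)) (j₀ : Fin (n + 1))
    (haj : (c = 0 ∧ (a : ℕ) = j₀ + 1) ∨ (c = 1 ∧ (a : ℕ) = j₀)) :
    (edgeTopLevel (layerEmb (n + 1) c (a, j₀.castSucc))).toNat = a + j₀ + 1 ∧
      (edgeTopLevel (layerEmb (n + 1) c (a, j₀.succ))).toNat = a + j₀ + 1 + 1 := by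
  rw [layerEmb_apply, edgeTopLevel_mk_colSite, layerEmb_apply, edgeTopLevel_mk_colSite]
  simp only [Fin.val_castSucc, Fin.val_succ]
  rcases haj with ⟨rfl, ha⟩ | ⟨rfl, ha⟩ <;> omega

/-- The levels of the two new edges of a target insertion. [folklore] -/
theorem edgeTopLevel_new_tgt {c : ℤ} (a : Fin (n + 2)) (j₀ : Fin (n + 1))
    (haj : (c = 0 ∧ (a : ℕ) = j₀) ∨ (c = 1 ∧ (a : ℕ) = j₀ + 1)) :
    (edgeTopLevel (layerEmb (n + 1) c (j₀.castSucc, a))).toNat = a + j₀ + 1 ∧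
      (edgeTopLevel (layerEmb (n + 1) c (j₀.succ, a))).toNat = a + j₀ + 1 + 1 := by
  rw [layerEmb_apply, edgeTopLevel_mk_colSite, layerEmb_apply, edgeTopLevel_mk_colSite]
  simp only [Fin.val_castSucc, Fin.val_succ]
  rcases haj with ⟨rfl, ha⟩ | ⟨rfl, ha⟩ <;> omega

end Weights

/-! ### One row of `t` after an insertion -/

section RowInsertion

variable {K : Type*} [Field K] {n : ℕ}

/-- **Row with an inserted singleton source** (weights `ipRowWeight q w z r`, new edges of total
open-weight `1`): the big row kernel is the push-forward along `cpInsDup j₀` of the small row kernel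
with rapidities `ẑ`. [cite: IkhlefPonsaing2012, Lemma 3.3] -/
theorem ipTransferW_cpInsIso {c : ℤ} (a : Fin (n + 2)) (j₀ : Fin (n + 1))
    (haj : (c = 0 ∧ (a : ℕ) = j₀ + 1) ∨ (c = 1 ∧ (a : ℕ) = j₀)) (q w : K) (z : ℕ → K) (r : Fin 2)
    (hnew : ipRowWeight q w z r (layerEmb (n + 1) c (a, j₀.castSucc)) *
      ipRowWeight q w z r (layerEmb (n + 1) c (a, j₀.succ)) = 1)
    (Q : ColPattern n) (P'' : ColPattern (n + 1)) :
    ipTransferW (n + 1) c (ipRowWeight q w z r) (cpInsIso a Q) P'' =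
      ∑ P' ∈ Finset.univ.filter (fun P' => cpInsDup j₀ P' = P''),
        ipTransferW n c (ipRowWeight q w (zHat z (a + j₀ + 1)) r) Q P' := by
  have haj' : (c % 2 = 0 ∧ (a : ℕ) = j₀ + 1) ∨ (c % 2 = 1 ∧ (a : ℕ) = j₀) := by
    rcases haj with ⟨rfl, h⟩ | ⟨rfl, h⟩
    · exact Or.inl ⟨by norm_num, h⟩
    · exact Or.inr ⟨by norm_num, h⟩
  rw [ipTransferW_eq_idx]
  simp_rw [ipTransferW_eq_idx (m := n)]
  exact ipTransferWIdx_cpInsIso c a j₀ haj' _ _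
    (fun p hp => ipRowWeight_layerEmb_insSrcIdx a j₀ haj q w z r hp) hnew Q P''

/-- **Row with a duplicated source** (new edges of total closed-weight `1`): the big row kernel is
the push-forward along `cpInsIso a` of the small row kernel with rapidities `ẑ`.
[cite: IkhlefPonsaing2012, Lemma 3.3] -/
theorem ipTransferW_cpInsDup {c : ℤ} (a : Fin (n + 2)) (j₀ : Fin (n + 1))
    (haj : (c = 0 ∧ (a : ℕ) = j₀) ∨ (c = 1 ∧ (a : ℕ) = j₀ + 1)) (q w : K) (z : ℕ → K) (r : Fin 2)
    (hnew : (1 - ipRowWeight q w z r (layerEmb (n + 1) c (j₀.castSucc, a))) *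
      (1 - ipRowWeight q w z r (layerEmb (n + 1) c (j₀.succ, a))) = 1)
    {Q : ColPattern n} (hQ : Q.1 j₀ j₀ = true) (P'' : ColPattern (n + 1)) :
    ipTransferW (n + 1) c (ipRowWeight q w z r) (cpInsDup j₀ Q) P'' =
      ∑ P' ∈ Finset.univ.filter (fun P' => cpInsIso a P' = P''),
        ipTransferW n c (ipRowWeight q w (zHat z (a + j₀ + 1)) r) Q P' := by
  have haj' : (c % 2 = 0 ∧ (a : ℕ) = j₀) ∨ (c % 2 = 1 ∧ (a : ℕ) = j₀ + 1) := by
    rcases haj with ⟨rfl, h⟩ | ⟨rfl, h⟩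
    · exact Or.inl ⟨by norm_num, h⟩
    · exact Or.inr ⟨by norm_num, h⟩
  rw [ipTransferW_eq_idx]
  simp_rw [ipTransferW_eq_idx (m := n)]
  exact ipTransferWIdx_cpInsDup c a j₀ haj' _ _
    (fun p hp => ipRowWeight_layerEmb_insTgtIdx a j₀ haj q w z r hp) hnew hQ P''

end RowInsertion

/-! ### Two rows: the transfer-matrix recursion -/

section Assembly

variable {K : Type*} [Field K] {n : ℕ}

/-- Lumping commutes with singleton insertion. [folklore] -/
theorem lump_cpInsIso (a : Fin (n + 2)) (P : ColPattern n) : lump (cpInsIso a P) = cpInsIso a (lump P) := by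
  refine Prod.ext (funext fun x => funext fun y => ?_) rfl
  rw [Bool.eq_iff_iff, lump_fst_eq_true_iff, cpInsIso_fst_iff, cpInsIso_fst_iff, cpInsIso_snd_iff,
    cpInsIso_snd_iff]
  simp only [lump_fst_eq_true_iff]
  constructor
  · rintro ((rfl | ⟨x', y', rfl, rfl, h⟩) | ⟨⟨x', rfl, hx⟩, ⟨y', rfl, hy⟩⟩)
    · exact Or.inl rfl
    · exact Or.inr ⟨x', y', rfl, rfl, Or.inl h⟩
    · exact Or.inr ⟨x', y', rfl, rfl, Or.inr ⟨hx, hy⟩⟩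
  · rintro (rfl | ⟨x', y', rfl, rfl, h | ⟨hx, hy⟩⟩)
    · exact Or.inl (Or.inl rfl)
    · exact Or.inl (Or.inr ⟨x', y', rfl, rfl, h⟩)
    · exact Or.inr ⟨⟨x', rfl, hx⟩, ⟨y', rfl, hy⟩⟩

/-- Lumping commutes with duplication. [folklore] -/
theorem lump_cpInsDup (j : Fin (n + 1)) (P : ColPattern n) : lump (cpInsDup j P) = cpInsDup j (lump P) := rfl

/-- The kernel vanishes at non-reflexive targets. [folklore] -/
theorem ipTransferW_eq_zero_of_not_refl {m : ℕ} (c : ℤ) (p : Sym2 (Site 2) → K) (P P' : ColPattern m)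
    {j : Fin (m + 1)} (hj : P'.1 j j = false) : ipTransferW m c p P P' = 0 := by
  classical
  unfold ipTransferW
  refine Finset.sum_eq_zero fun U _ => if_neg fun hU => ?_
  rw [← hU, colUpdate_fst_self] at hj
  exact Bool.noConfusion hj

/-- A fibre sum against a function of the fibre. [folklore] -/
theorem sum_fiber_mul {γ δ : Type*} [Fintype γ] [Fintype δ] [DecidableEq δ] (g : γ → δ) (f : γ → K)
    (h : δ → K) : ∑ y, (∑ x ∈ Finset.univ.filter (fun x => g x = y), f x) * h y = ∑ x, f x * h (g x) := by
  simp_rw [Finset.sum_mul]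
  rw [← Finset.sum_fiberwise_of_maps_to (s := Finset.univ) (t := Finset.univ) (g := g)
    (fun _ _ => Finset.mem_univ _) (fun x => f x * h (g x))]
  refine Finset.sum_congr rfl fun y _ => Finset.sum_congr rfl fun x hx => ?_
  rw [(Finset.mem_filter.1 hx).2]

/-- Iterated fibre sums. [folklore] -/
theorem sum_filter_fiber {γ δ ε : Type*} [Fintype γ] [Fintype δ] [DecidableEq δ] [DecidableEq ε]
    (φ : γ → δ) (L : δ → ε) (e : ε) (f : γ → K) :
    ∑ y ∈ Finset.univ.filter (fun y => L y = e), ∑ x ∈ Finset.univ.filter (fun x => φ x = y), f x =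
      ∑ x ∈ Finset.univ.filter (fun x => L (φ x) = e), f x := by
  rw [← Finset.sum_fiberwise_of_maps_to (s := Finset.univ.filter (fun x => L (φ x) = e))
    (t := Finset.univ.filter (fun y => L y = e)) (g := φ) (fun x hx => by simpa using hx) f]
  refine Finset.sum_congr rfl fun y hy => Finset.sum_congr ?_ fun _ _ => rfl
  ext x
  simp only [Finset.mem_filter, Finset.mem_univ, true_and] at hy ⊢
  constructor
  · intro hx; exact ⟨by rw [hx]; exact hy, hx⟩
  · exact fun h => h.2

/-- **Two-row push-forward principle**: if row `0` pushes `φ Q` forward along `φ'` and row `1` pushes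
every reachable `φ' P₁` forward along `φ`, and `φ` commutes with lumping, then the lumped two-row
kernel from `φ Q` is the push-forward along `φ` of the small one. [cite: IkhlefPonsaing2012, Lemma 3.3] -/
theorem ipTwoLayerW_push {φ φ' : ColPattern n → ColPattern (n + 1)} (p₀' p₁' p₀ p₁ : Sym2 (Site 2) → K)
    (Q : ColPattern n)
    (row0 : ∀ P₁', ipTransferW (n + 1) 0 p₀' (φ Q) P₁' =
      ∑ P₁ ∈ Finset.univ.filter (fun P₁ => φ' P₁ = P₁'), ipTransferW n 0 p₀ Q P₁)
    (row1 : ∀ P₁, ipTransferW n 0 p₀ Q P₁ ≠ 0 → ∀ P₂', ipTransferW (n + 1) 1 p₁' (φ' P₁) P₂' =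
      ∑ P₂ ∈ Finset.univ.filter (fun P₂ => φ P₂ = P₂'), ipTransferW n 1 p₁ P₁ P₂)
    (hlump : ∀ P, lump (φ P) = φ (lump P)) (Q'' : ColPattern (n + 1)) :
    ipTwoLayerW (n + 1) p₀' p₁' (φ Q) Q'' =
      ∑ Q' ∈ Finset.univ.filter (fun Q' => φ Q' = Q''), ipTwoLayerW n p₀ p₁ Q Q' := by
  classical
  unfold ipTwoLayerW
  simp_rw [← Finset.mul_sum, row0]
  rw [sum_fiber_mul]
  conv_rhs => rw [Finset.sum_comm]
  refine Finset.sum_congr rfl fun P₁ _ => ?_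
  rw [← Finset.mul_sum]
  by_cases h0 : ipTransferW n 0 p₀ Q P₁ = 0
  · rw [h0, zero_mul, zero_mul]
  congr 1
  simp_rw [row1 P₁ h0]
  rw [sum_filter_fiber, sum_filter_fiber]
  simp_rw [hlump]

/-- `q ≠ 0` at `q² + q + 1 = 0`. [folklore] -/
theorem q_ne_zero_of_quad {q : K} (hq : q ^ 2 + q + 1 = 0) : q ≠ 0 := by
  rintro rfl; norm_num at hq

/-- **IP12 Lemma 3.3 (transfer-matrix recursion), even insertion point `i = 2b`**: at
`z_{i+1} = q z_i` the transfer matrix `t_L(w; z)` maps the inserted states `φ_i Q = cpInsIso b Q` to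
inserted states, acting inside as `t_{L-2}(w; ẑ)`:
`t_L(z_{i+1} = q z_i) ∘ φ_i = φ_i ∘ t_{L-2}(ẑ)` (entrywise, for arbitrary inhomogeneities, over any
field with `q² + q + 1 = 0`, away from the poles of the weights). [cite: IkhlefPonsaing2012, Lemma 3.3] -/
theorem ipTransferMatrixW_cpInsIso {q : K} (hq : q ^ 2 + q + 1 = 0) (w : K) (z : ℕ → K)
    (b : Fin (n + 2)) (hb : b ≠ 0) (hz : z (2 * b + 1) = q * z (2 * b))
    (h₁ : qbr (z (2 * b) / w) ≠ 0) (h₂ : qbr (q / (z (2 * b) / w)) ≠ 0)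
    (h₃ : qbr (w * z (2 * b + 1))⁻¹ ≠ 0) (h₄ : qbr (q / (w * z (2 * b + 1))⁻¹) ≠ 0)
    (h₅ : qbr (q / (q * (w * z (2 * b + 1))⁻¹)) ≠ 0)
    (Q : ColPattern n) (Q'' : ColPattern (n + 1)) :
    ipTransferMatrixW (n + 1) q w z (cpInsIso b Q) Q'' =
      ∑ Q' ∈ Finset.univ.filter (fun Q' => cpInsIso b Q' = Q''), ipTransferMatrixW n q w (zHat z (2 * b)) Q Q' := by
  classical
  have hq0 : q ≠ 0 := q_ne_zero_of_quad hq
  set j₀ : Fin (n + 1) := b.pred hb with hj₀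
  have hbv : (b : ℕ) ≠ 0 := fun h => hb (Fin.ext h)
  have hj₀v : (j₀ : ℕ) = b - 1 := by rw [hj₀, Fin.val_pred]
  have hajS : ((0 : ℤ) = 0 ∧ (b : ℕ) = j₀ + 1) ∨ ((0 : ℤ) = 1 ∧ (b : ℕ) = j₀) := Or.inl ⟨rfl, by omega⟩
  have hajT : ((1 : ℤ) = 0 ∧ (b : ℕ) = j₀) ∨ ((1 : ℤ) = 1 ∧ (b : ℕ) = j₀ + 1) := Or.inr ⟨rfl, by omega⟩
  have hi : (b : ℕ) + j₀ + 1 = 2 * b := by omega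
  have hev : ¬ ((2 * (b : ℕ)) % 2 = 1) := by omega
  have hodd : (2 * (b : ℕ) + 1) % 2 = 1 := by omega
  -- the two fusion identities
  have hnew0 : ipRowWeight q w z 0 (layerEmb (n + 1) 0 (b, j₀.castSucc)) *
      ipRowWeight q w z 0 (layerEmb (n + 1) 0 (b, j₀.succ)) = 1 := by
    obtain ⟨hl1, hl2⟩ := edgeTopLevel_new_src (c := 0) b j₀ hajS
    rw [hi] at hl1 hl2
    rw [ipRowWeight_eq_of_level q w z 0 hl1, ipRowWeight_eq_of_level q w z 0 hl2]
    simp only [hev, hodd, if_false, if_true]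
    rw [hz, mul_div_assoc, mul_comm]
    exact ipWtA_qmul_mul_ipWtB hq h₁ h₂
  have hnew1 : (1 - ipRowWeight q w z 1 (layerEmb (n + 1) 1 (j₀.castSucc, b))) *
      (1 - ipRowWeight q w z 1 (layerEmb (n + 1) 1 (j₀.succ, b))) = 1 := by
    obtain ⟨hl1, hl2⟩ := edgeTopLevel_new_tgt (c := 1) b j₀ hajT
    rw [hi] at hl1 hl2
    rw [ipRowWeight_eq_of_level q w z 1 hl1, ipRowWeight_eq_of_level q w z 1 hl2]
    simp only [hev, hodd, if_false, if_true, show (1 : Fin 2) ≠ 0 by decide]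
    have key : (w * z (2 * b))⁻¹ = q * (w * z (2 * b + 1))⁻¹ := by
      rw [hz, mul_inv, mul_inv, mul_inv, mul_left_comm q w⁻¹, ← mul_assoc q q⁻¹, mul_inv_cancel₀ hq0,
        one_mul]
    rw [key, mul_comm]
    exact one_sub_ipWtA_mul_one_sub_ipWtB hq h₃ h₄ h₅
  rw [ipTransferMatrixW_eq]
  simp_rw [ipTransferMatrixW_eq (m := n)]
  rw [← hi]
  refine ipTwoLayerW_push _ _ _ _ Q (fun P₁' => ipTransferW_cpInsIso b j₀ hajS q w z 0 hnew0 Q P₁')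
    (fun P₁ hP₁ P₂' => ?_) (lump_cpInsIso b) Q''
  have hrefl : P₁.1 j₀ j₀ = true := by
    by_contra h
    exact hP₁ (ipTransferW_eq_zero_of_not_refl 0 _ Q P₁ (Bool.eq_false_iff.2 h))
  exact ipTransferW_cpInsDup b j₀ hajT q w z 1 hnew1 hrefl P₂'

/-- **IP12 Lemma 3.3 (transfer-matrix recursion), odd insertion point `i = 2j+1`**: at
`z_{i+1} = q z_i`, `t_L(w; z) ∘ φ_i = φ_i ∘ t_{L-2}(w; ẑ)` with `φ_i Q = cpInsDup j Q` (for reflexive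
`Q` at `j`). [cite: IkhlefPonsaing2012, Lemma 3.3] -/
theorem ipTransferMatrixW_cpInsDup {q : K} (hq : q ^ 2 + q + 1 = 0) (w : K) (z : ℕ → K)
    (j : Fin (n + 1)) (hz : z (2 * j + 1 + 1) = q * z (2 * j + 1))
    (h₁ : qbr (z (2 * j + 1) / w) ≠ 0) (h₂ : qbr (q / (z (2 * j + 1) / w)) ≠ 0)
    (h₃ : qbr (q / (q * (z (2 * j + 1) / w))) ≠ 0)
    (h₄ : qbr (w * z (2 * j + 1 + 1))⁻¹ ≠ 0) (h₅ : qbr (q / (w * z (2 * j + 1 + 1))⁻¹) ≠ 0)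
    {Q : ColPattern n} (hQ : Q.1 j j = true) (Q'' : ColPattern (n + 1)) :
    ipTransferMatrixW (n + 1) q w z (cpInsDup j Q) Q'' =
      ∑ Q' ∈ Finset.univ.filter (fun Q' => cpInsDup j Q' = Q''),
        ipTransferMatrixW n q w (zHat z (2 * j + 1)) Q Q' := by
  classical
  have hq0 : q ≠ 0 := q_ne_zero_of_quad hq
  set a : Fin (n + 2) := j.castSucc with ha
  have hav : (a : ℕ) = j := by rw [ha, Fin.val_castSucc]
  have hajT : ((0 : ℤ) = 0 ∧ (a : ℕ) = j) ∨ ((0 : ℤ) = 1 ∧ (a : ℕ) = j + 1) := Or.inl ⟨rfl, hav⟩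
  have hajS : ((1 : ℤ) = 0 ∧ (a : ℕ) = j + 1) ∨ ((1 : ℤ) = 1 ∧ (a : ℕ) = j) := Or.inr ⟨rfl, hav⟩
  have hi : (a : ℕ) + j + 1 = 2 * j + 1 := by omega
  have hodd : (2 * (j : ℕ) + 1) % 2 = 1 := by omega
  have hev : ¬ ((2 * (j : ℕ) + 1 + 1) % 2 = 1) := by omega
  have hnew0 : (1 - ipRowWeight q w z 0 (layerEmb (n + 1) 0 (j.castSucc, a))) *
      (1 - ipRowWeight q w z 0 (layerEmb (n + 1) 0 (j.succ, a))) = 1 := by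
    obtain ⟨hl1, hl2⟩ := edgeTopLevel_new_tgt (c := 0) a j hajT
    rw [hi] at hl1 hl2
    rw [ipRowWeight_eq_of_level q w z 0 hl1, ipRowWeight_eq_of_level q w z 0 hl2]
    simp only [hev, hodd, if_false, if_true]
    rw [hz, mul_div_assoc]
    exact one_sub_ipWtA_mul_one_sub_ipWtB hq h₁ h₂ h₃
  have hnew1 : ipRowWeight q w z 1 (layerEmb (n + 1) 1 (a, j.castSucc)) *
      ipRowWeight q w z 1 (layerEmb (n + 1) 1 (a, j.succ)) = 1 := by
    obtain ⟨hl1, hl2⟩ := edgeTopLevel_new_src (c := 1) a j hajS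
    rw [hi] at hl1 hl2
    rw [ipRowWeight_eq_of_level q w z 1 hl1, ipRowWeight_eq_of_level q w z 1 hl2]
    simp only [hev, hodd, if_false, if_true, show (1 : Fin 2) ≠ 0 by decide]
    have key : (w * z (2 * j + 1))⁻¹ = q * (w * z (2 * j + 1 + 1))⁻¹ := by
      rw [hz, mul_inv, mul_inv, mul_inv, mul_left_comm q w⁻¹, ← mul_assoc q q⁻¹, mul_inv_cancel₀ hq0,
        one_mul]
    rw [key]
    exact ipWtA_qmul_mul_ipWtB hq h₄ h₅
  rw [ipTransferMatrixW_eq]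
  simp_rw [ipTransferMatrixW_eq (m := n)]
  rw [← hi]
  refine ipTwoLayerW_push _ _ _ _ Q (fun P₁' => ipTransferW_cpInsDup a j hajT q w z 0 hnew0 hQ P₁')
    (fun P₁ _ P₂' => ipTransferW_cpInsIso a j hajS q w z 1 hnew1 P₁ P₂') (lump_cpInsDup j) Q''

/-- `cpInsIso b` is injective on reflexive patterns. [folklore] -/
theorem cpInsIso_inj_of_refl {b : Fin (n + 2)} {P Q : ColPattern n} (hP : ∀ i, P.1 i i = true)
    (hQ : ∀ i, Q.1 i i = true) (h : cpInsIso b P = cpInsIso b Q) : P = Q := by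
  have h1 : ∀ x y, (cpInsIso b P).1 x y = (cpInsIso b Q).1 x y := fun x y => by rw [h]
  have h2 : ∀ x, (cpInsIso b P).2 x = (cpInsIso b Q).2 x := fun x => by rw [h]
  refine Prod.ext (funext fun x => funext fun y => ?_) (funext fun x => ?_)
  · have := h1 (b.succAbove x) (b.succAbove y)
    change SiteRel.insertIso P.1 b _ _ = SiteRel.insertIso Q.1 b _ _ at this
    rwa [SiteRel.insertIso_succAbove hP, SiteRel.insertIso_succAbove hQ] at this
  · have := h2 (b.succAbove x)
    rw [Bool.eq_iff_iff, cpInsIso_snd_iff, cpInsIso_snd_iff] at this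
    simp only [Fin.succAbove_right_inj, exists_eq_left] at this
    rw [Bool.eq_iff_iff]; exact this

/-- `cpInsDup j` is injective. [folklore] -/
theorem cpInsDup_injective (j : Fin (n + 1)) : Function.Injective (cpInsDup (n := n) j) := by
  intro P Q h
  have h1 : ∀ x y, (cpInsDup j P).1 x y = (cpInsDup j Q).1 x y := fun x y => by rw [h]
  have h2 : ∀ x, (cpInsDup j P).2 x = (cpInsDup j Q).2 x := fun x => by rw [h]
  refine Prod.ext (funext fun x => funext fun y => ?_) (funext fun x => ?_)
  · have := h1 ((Fin.castSucc j).succAbove x) ((Fin.castSucc j).succAbove y)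
    rwa [cpInsDup_fst, cpInsDup_fst, Fin.predAbove_succAbove, Fin.predAbove_succAbove] at this
  · have := h2 ((Fin.castSucc j).succAbove x)
    rwa [cpInsDup_snd, cpInsDup_snd, Fin.predAbove_succAbove] at this

/-- `t` vanishes at non-reflexive targets. [folklore] -/
theorem ipTransferMatrixW_eq_zero_of_not_refl {m : ℕ} (q w : K) (z : ℕ → K) (Q Q' : ColPattern m)
    {j : Fin (m + 1)} (hj : Q'.1 j j = false) : ipTransferMatrixW m q w z Q Q' = 0 := by
  classical
  unfold ipTransferMatrixW
  refine Finset.sum_eq_zero fun P₁ _ => Finset.sum_eq_zero fun P₂ hP₂ => ?_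
  have hl : lump P₂ = Q' := (Finset.mem_filter.1 hP₂).2
  have hP₂j : P₂.1 j j = false := by
    have := congrArg (fun P : ColPattern m => P.1 j j) hl
    simp only [lump_fst, hj, Bool.or_eq_false_iff] at this
    exact this.1
  rw [ipTransferW_eq_zero_of_not_refl 1 _ P₁ P₂ hP₂j, mul_zero]

/-- **Corollary (even `i`): the recursion on inserted states.** [cite: IkhlefPonsaing2012, Lemma 3.3] -/
theorem ipTransferMatrixW_cpInsIso_cpInsIso {q : K} (hq : q ^ 2 + q + 1 = 0) (w : K) (z : ℕ → K)
    (b : Fin (n + 2)) (hb : b ≠ 0) (hz : z (2 * b + 1) = q * z (2 * b))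
    (h₁ : qbr (z (2 * b) / w) ≠ 0) (h₂ : qbr (q / (z (2 * b) / w)) ≠ 0)
    (h₃ : qbr (w * z (2 * b + 1))⁻¹ ≠ 0) (h₄ : qbr (q / (w * z (2 * b + 1))⁻¹) ≠ 0)
    (h₅ : qbr (q / (q * (w * z (2 * b + 1))⁻¹)) ≠ 0) (Q : ColPattern n) {Q' : ColPattern n}
    (hQ' : ∀ i, Q'.1 i i = true) :
    ipTransferMatrixW (n + 1) q w z (cpInsIso b Q) (cpInsIso b Q') =
      ipTransferMatrixW n q w (zHat z (2 * b)) Q Q' := by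
  classical
  rw [ipTransferMatrixW_cpInsIso hq w z b hb hz h₁ h₂ h₃ h₄ h₅, Finset.sum_eq_single_of_mem Q' (by simp)]
  intro P hP hPQ
  by_cases hrefl : ∀ i, P.1 i i = true
  · exact absurd (cpInsIso_inj_of_refl hrefl hQ' (Finset.mem_filter.1 hP).2) hPQ
  · obtain ⟨i, hi⟩ := not_forall.1 hrefl
    exact ipTransferMatrixW_eq_zero_of_not_refl _ _ _ Q P (Bool.eq_false_iff.2 hi)

/-- **Corollary (even `i`): `t` does not lead out of the inserted states.** [cite: IkhlefPonsaing2012, Lemma 3.3] -/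
theorem ipTransferMatrixW_cpInsIso_eq_zero {q : K} (hq : q ^ 2 + q + 1 = 0) (w : K) (z : ℕ → K)
    (b : Fin (n + 2)) (hb : b ≠ 0) (hz : z (2 * b + 1) = q * z (2 * b))
    (h₁ : qbr (z (2 * b) / w) ≠ 0) (h₂ : qbr (q / (z (2 * b) / w)) ≠ 0)
    (h₃ : qbr (w * z (2 * b + 1))⁻¹ ≠ 0) (h₄ : qbr (q / (w * z (2 * b + 1))⁻¹) ≠ 0)
    (h₅ : qbr (q / (q * (w * z (2 * b + 1))⁻¹)) ≠ 0) (Q : ColPattern n) {Q'' : ColPattern (n + 1)}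
    (hQ'' : ∀ Q', cpInsIso b Q' ≠ Q'') : ipTransferMatrixW (n + 1) q w z (cpInsIso b Q) Q'' = 0 := by
  classical
  rw [ipTransferMatrixW_cpInsIso hq w z b hb hz h₁ h₂ h₃ h₄ h₅]
  exact Finset.sum_eq_zero fun P hP => absurd (Finset.mem_filter.1 hP).2 (hQ'' P)

/-- **Corollary (odd `i`): the recursion on inserted states.** [cite: IkhlefPonsaing2012, Lemma 3.3] -/
theorem ipTransferMatrixW_cpInsDup_cpInsDup {q : K} (hq : q ^ 2 + q + 1 = 0) (w : K) (z : ℕ → K)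
    (j : Fin (n + 1)) (hz : z (2 * j + 1 + 1) = q * z (2 * j + 1))
    (h₁ : qbr (z (2 * j + 1) / w) ≠ 0) (h₂ : qbr (q / (z (2 * j + 1) / w)) ≠ 0)
    (h₃ : qbr (q / (q * (z (2 * j + 1) / w))) ≠ 0)
    (h₄ : qbr (w * z (2 * j + 1 + 1))⁻¹ ≠ 0) (h₅ : qbr (q / (w * z (2 * j + 1 + 1))⁻¹) ≠ 0)
    {Q : ColPattern n} (hQ : Q.1 j j = true) (Q' : ColPattern n) :
    ipTransferMatrixW (n + 1) q w z (cpInsDup j Q) (cpInsDup j Q') =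
      ipTransferMatrixW n q w (zHat z (2 * j + 1)) Q Q' := by
  classical
  rw [ipTransferMatrixW_cpInsDup hq w z j hz h₁ h₂ h₃ h₄ h₅ hQ, Finset.sum_eq_single_of_mem Q' (by simp)]
  intro P hP hPQ
  exact absurd (cpInsDup_injective j (Finset.mem_filter.1 hP).2) hPQ

/-- **Corollary (odd `i`): `t` does not lead out of the inserted states.** [cite: IkhlefPonsaing2012, Lemma 3.3] -/
theorem ipTransferMatrixW_cpInsDup_eq_zero {q : K} (hq : q ^ 2 + q + 1 = 0) (w : K) (z : ℕ → K)
    (j : Fin (n + 1)) (hz : z (2 * j + 1 + 1) = q * z (2 * j + 1))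
    (h₁ : qbr (z (2 * j + 1) / w) ≠ 0) (h₂ : qbr (q / (z (2 * j + 1) / w)) ≠ 0)
    (h₃ : qbr (q / (q * (z (2 * j + 1) / w))) ≠ 0)
    (h₄ : qbr (w * z (2 * j + 1 + 1))⁻¹ ≠ 0) (h₅ : qbr (q / (w * z (2 * j + 1 + 1))⁻¹) ≠ 0)
    {Q : ColPattern n} (hQ : Q.1 j j = true) {Q'' : ColPattern (n + 1)} (hQ'' : ∀ Q', cpInsDup j Q' ≠ Q'') :
    ipTransferMatrixW (n + 1) q w z (cpInsDup j Q) Q'' = 0 := by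
  classical
  rw [ipTransferMatrixW_cpInsDup hq w z j hz h₁ h₂ h₃ h₄ h₅ hQ]
  exact Finset.sum_eq_zero fun P hP => absurd (Finset.mem_filter.1 hP).2 (hQ'' P)

end Assembly

end Literature.Probability.Percolation
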